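import Summits.QuantumFields.YangMills.Theorems.ConvexGribovBodyPoincareToGapSliceCovSum
import Summits.QuantumFields.YangMills.Theorems.ConvexGribovBodyPoincareToGapAxisSwap
import Summits.QuantumFields.YangMills.Theorems.ConvexGribovBodyPoincareToGapAxisSwapTransport
import Summits.QuantumFields.YangMills.Theorems.ConvexGribovBodyPoincareToGapCovLogConvex
import Summits.QuantumFields.YangMills.Theorems.ConvexGribovBodyPoincareToGapAntitone
import Summits.QuantumFields.YangMills.Theorems.ConvexGribovBodyBrascampLiebVacuumStubRpHankel

/-!
# Temporal decay of layer autocovariances from the slice Poincaré hypothesis alone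
(crux `ConvexGribovBody.PoincareToGap`, stmt-QuantumFields-8781, line `Sketch`, lead c2, §3 of `Lines/Sketch.lean`)

The crux asks: a Poincaré inequality `Var_μ f ≤ κ · dir f` for the law of the time-zero slice of Wilson's lattice
Yang–Mills measure `μ = μ_{β,S}` on the SYMMETRIC tori `(2S+1)⁴` (all gauge-invariant link-Lipschitz `f` of the
time-zero spatial links; `dir` = sum over those links of `∫ |∇_ℓ f|²`, metric slope) implies volume-uniform
EXPONENTIAL time-clustering.  This file records what the hypothesis yields with no further input — a
volume-uniform POWER LAW for layer observables:

* `temporalDecay_of_slicePoincare`: on one torus (`S ≥ 1`, `β ≥ 0`, `κ ≥ 0`), if the slice Poincaré inequality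
  holds at `S`, then every bounded measurable gauge-invariant link-Lipschitz observable `A` of the `(2,3)`-layer
  `Λ₀ = {t = 0, x₁ = 0, directions 2, 3}` satisfies `Cov_μ(A, A ∘ T⁰_n) ≤ κ · dir(A) / (n+1)` for `0 ≤ n ≤ S`
  (`T⁰_n = torusConfigShift (n e₀)`, translation by `n` units of Euclidean time);
* `temporalDecay_of_sliceHypothesis`: the same under the crux's hypothesis AS TYPED (`∀ S ≥ S₀`), for all
  `S ≥ max S₀ 1`, with measurability and boundedness of `A` derived from the Lipschitz condition
  (`rpHankel_continuous`; `G` is second countable through the faithful `r`).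

Mechanism (all five ingredients are landed stubs of the line): the axis swap `0 ↔ 1` leaves `μ` invariant
(`stub_wilsonMeasure_map_axisSwap`, hypercubic symmetry), so the slice Poincaré inequality transported to the
observable `A ∘ Φ` and applied to the sum of its `2S+1` translates in direction `1` (`stub_sliceCovSum_le`:
the translates read disjoint links, `dir` is additive, the variance of the sum is `(2S+1) Σ_y Cov`) is, read back
through the swap (`stub_axisSwap_transport`), the TEMPORAL susceptibility bound `Σ_{n ∈ ℤ_{2S+1}} c(n) ≤ κ dir A`,
`c(n) := Cov(A, A ∘ T⁰_n)`; odd-torus reflection positivity makes `c` non-negative, even and log-convex off `0`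
(`stub_cov_nonneg_logConvex`), hence non-increasing on `[0, S]` (`stub_antitone_of_logConvex`), and
`(n+1) c(n) ≤ Σ_{m ≤ n} c(m) ≤ Σ_m c(m) ≤ κ dir A`.

What is NOT here: the exponential rate.  Slice Poincaré + reflection positivity + the Markov property in time
do not imply exponential temporal decay in general (a stationary Gaussian hidden-Ornstein–Uhlenbeck chain has all
three with polynomially decaying autocovariances); the exponential rate needs the smoothing of Wilson's one-step
kernel quantitatively — the line's open cores PB1/PB2.  References: Osterwalder–Seiler, Ann. Phys. 110 (1978)
§2 (reflection positivity); the peeling line `Cruxes/PoincareToGap/Lines/Sketch.lean`. [folklore]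
-/

noncomputable section

open scoped BigOperators Topology
open MeasureTheory Filter
open Literature.MathematicalPhysics.QuantumFieldTheory

namespace Summit.QuantumFields.YangMills.Theorems.PoincareToGap

/-- **What the crux hypothesis gives with no further input: `Cov_S(A, τ_n A) ≤ κ · dir(A) / (n+1)`, `n ≤ S`.**
On one torus `(2S+1)⁴` (`S ≥ 1`, `β ≥ 0`, `κ ≥ 0`), if the slice Poincaré inequality of the crux holds at this `S`
with constant `κ`, then every bounded measurable gauge-invariant link-Lipschitz observable `A` of the `(2,3)`-layer
`Λ₀ = {t = 0, x₁ = 0, directions 2, 3}` has temporal autocovariances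
`Cov_μ(A, A ∘ T⁰_n) ≤ κ · dir(A) / (n + 1)` for all `0 ≤ n ≤ S`, with `dir` the crux's time-zero Dirichlet form.
Composition of the five landed stubs F1–F4b (module docstring). [folklore] -/
theorem temporalDecay_of_slicePoincare :
    ∀ (G : Type) [Group G] [TopologicalSpace G] [IsTopologicalGroup G] [CompactSpace G]
      [MeasurableSpace G] [BorelSpace G] (r : LatticeRep G) (β : ℝ), 0 ≤ β → ∀ κ : ℝ, 0 ≤ κ → ∀ S : ℕ, 1 ≤ S →
    (∀ f : GaugeConfig 4 (2 * S + 1) G → ℝ, IsGaugeInvariant f →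
      (∀ U V : GaugeConfig 4 (2 * S + 1) G,
        (∀ e : Edge 4 (2 * S + 1), e.1 0 = 0 → e.2 ≠ 0 → U e = V e) → f U = f V) →
      (∃ K : ℝ, ∀ U V : GaugeConfig 4 (2 * S + 1) G,
        |f U - f V| ≤ K * ∑ e, Real.sqrt (∑ a, ∑ b, ‖(r.ρ (U e) - r.ρ (V e)) a b‖ ^ 2)) →
      ∫ U, (f U - ∫ V, f V ∂(wilsonMeasure r.ρ β : Measure (GaugeConfig 4 (2 * S + 1) G))) ^ 2
          ∂(wilsonMeasure r.ρ β : Measure (GaugeConfig 4 (2 * S + 1) G)) ≤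
        κ * ∑ e : Edge 4 (2 * S + 1), (if e.1 0 = 0 ∧ e.2 ≠ 0 then
          ∫ U, (Filter.limsup (fun g : G => |f (Function.update U e g) - f U| /
              Real.sqrt (∑ a, ∑ b, ‖(r.ρ g - r.ρ (U e)) a b‖ ^ 2)) (𝓝[≠] (U e))) ^ 2
            ∂(wilsonMeasure r.ρ β : Measure (GaugeConfig 4 (2 * S + 1) G)) else 0)) →
    ∀ μ : Measure (GaugeConfig 4 (2 * S + 1) G),
      μ = (wilsonMeasure r.ρ β : Measure (GaugeConfig 4 (2 * S + 1) G)) →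
    ∀ A : GaugeConfig 4 (2 * S + 1) G → ℝ, Measurable A → (∃ M : ℝ, ∀ U, |A U| ≤ M) →
      IsGaugeInvariant A →
      DependsOn A {e : Edge 4 (2 * S + 1) | e.1 0 = 0 ∧ e.1 1 = 0 ∧ e.2 ≠ 0 ∧ e.2 ≠ 1} →
      (∃ K : ℝ, ∀ U V : GaugeConfig 4 (2 * S + 1) G,
        |A U - A V| ≤ K * ∑ e, Real.sqrt (∑ a, ∑ b, ‖(r.ρ (U e) - r.ρ (V e)) a b‖ ^ 2)) →
    ∀ n : ℕ, n ≤ S →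
      ∫ U, A U * A (torusConfigShift (Pi.single (0 : Fin 4) (n : ZMod (2 * S + 1)) : Site 4 (2 * S + 1)) U) ∂μ -
          (∫ U, A U ∂μ) * ∫ U, A U ∂μ ≤
        κ * (∑ e : Edge 4 (2 * S + 1), (if e.1 0 = 0 ∧ e.2 ≠ 0 then
          ∫ U, (Filter.limsup (fun g : G => |A (Function.update U e g) - A U| /
              Real.sqrt (∑ a, ∑ b, ‖(r.ρ g - r.ρ (U e)) a b‖ ^ 2)) (𝓝[≠] (U e))) ^ 2 ∂μ else 0)) /
          ((n : ℝ) + 1) := by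
  intro G _ _ _ _ _ _ r β hβ κ hκ S hS hP μ hμ A hAm hAb hAg hAd hAl n hn
  -- F2 ⟶ F3: the axis swap `0 ↔ 1` leaves `μ` invariant and transports `A`
  have hΦ : μ.map (fun (U : GaugeConfig 4 (2 * S + 1) G) (e : Edge 4 (2 * S + 1)) =>
      U (fun k => e.1 (Equiv.swap 0 1 k), Equiv.swap 0 1 e.2)) = μ := by
    subst hμ
    exact stub_wilsonMeasure_map_axisSwap G r β 4 (2 * S + 1) 0 1
  obtain ⟨⟨hBm, hBb, hBg, hBd, hBl⟩, hsum, hdir⟩ :=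
    stub_axisSwap_transport G r β S μ hμ hΦ A hAm hAb hAg hAd hAl
  -- F1 for the transported observable, rewritten by F3: the temporal susceptibility bound
  have h1 := stub_sliceCovSum_le G r β κ hκ S hP μ hμ
    (fun U : GaugeConfig 4 (2 * S + 1) G =>
      A (fun e => U (fun k => e.1 (Equiv.swap 0 1 k), Equiv.swap 0 1 e.2))) hBm hBb hBg hBd hBl
  rw [hsum, hdir] at h1
  -- F4, F4b: `c` is non-negative and non-increasing on `[0, S]`
  set c : ZMod (2 * S + 1) → ℝ := fun m =>
    ∫ U, A U * A (torusConfigShift (Pi.single (0 : Fin 4) m : Site 4 (2 * S + 1)) U) ∂μ -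
      (∫ U, A U ∂μ) * ∫ U, A U ∂μ with hc
  obtain ⟨hnn, hev, hlc⟩ := stub_cov_nonneg_logConvex G r β hβ S hS μ hμ A hAm hAb
    (hAd.mono fun e he => ⟨he.1, he.2.2.1⟩)
  have hnn' : ∀ m, 0 ≤ c m := fun m => hnn m
  have hev' : ∀ m, c (-m) = c m := fun m => by simp only [hc, hev m]
  have hlc' : ∀ m, m ≠ 0 → c m ^ 2 ≤ c (m - 1) * c (m + 1) := fun m hm => hlc m hm
  have hanti := stub_antitone_of_logConvex S c hnn' hev' hlc'
  -- `(n+1) c(n) ≤ Σ_{m ≤ n} c(m) ≤ Σ_m c(m) ≤ κ dir A`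
  have hL : n + 1 ≤ 2 * S + 1 := by omega
  have hstep : ((n : ℝ) + 1) * c (n : ZMod (2 * S + 1)) ≤
      ∑ m ∈ Finset.range (n + 1), c ((m : ℕ) : ZMod (2 * S + 1)) := by
    have hterm : ∀ m ∈ Finset.range (n + 1),
        c (n : ZMod (2 * S + 1)) ≤ c ((m : ℕ) : ZMod (2 * S + 1)) := fun m hm =>
      hanti m n (by simpa [Finset.mem_range, Nat.lt_succ_iff] using hm) hn
    calc ((n : ℝ) + 1) * c (n : ZMod (2 * S + 1))
        = ∑ _m ∈ Finset.range (n + 1), c (n : ZMod (2 * S + 1)) := by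
          simp [Finset.sum_const, Finset.card_range]
      _ ≤ ∑ m ∈ Finset.range (n + 1), c ((m : ℕ) : ZMod (2 * S + 1)) := Finset.sum_le_sum hterm
  have hinj : ∀ x ∈ Finset.range (n + 1), ∀ y ∈ Finset.range (n + 1),
      ((x : ℕ) : ZMod (2 * S + 1)) = ((y : ℕ) : ZMod (2 * S + 1)) → x = y := by
    intro x hx y hy hxy
    have hx' : x < 2 * S + 1 := by simp [Finset.mem_range] at hx; omega
    have hy' : y < 2 * S + 1 := by simp [Finset.mem_range] at hy; omega
    have := congrArg ZMod.val hxy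
    rwa [ZMod.val_cast_of_lt hx', ZMod.val_cast_of_lt hy'] at this
  have hsub : ∑ m ∈ Finset.range (n + 1), c ((m : ℕ) : ZMod (2 * S + 1)) ≤ ∑ m, c m := by
    rw [← Finset.sum_image hinj]
    exact Finset.sum_le_univ_sum_of_nonneg hnn'
  have hpos : (0 : ℝ) < (n : ℝ) + 1 := by positivity
  rw [le_div_iff₀ hpos]
  have hmain : ((n : ℝ) + 1) * c (n : ZMod (2 * S + 1)) ≤ ∑ m, c m := hstep.trans hsub
  have hfin : c (n : ZMod (2 * S + 1)) * ((n : ℝ) + 1) ≤ _ := (mul_comm _ _).le.trans (hmain.trans h1)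
  simpa only [hc] using hfin

/-- **The crux hypothesis AS TYPED implies volume-uniform power-law temporal clustering of layer observables.**
If `0 ≤ β`, `0 ≤ κ` and the antecedent of `ConvexGribovBody.PoincareToGap` holds from `S₀` on (slice Poincaré
with constant `κ` on every torus `(2S+1)⁴`, `S ≥ S₀`), then on every torus with `S ≥ S₀` and `S ≥ 1`, every
gauge-invariant link-Lipschitz observable `A` of the `(2,3)`-layer `Λ₀` satisfies
`Cov_{μ_{β,S}}(A, A ∘ T⁰_n) ≤ κ · dir(A) / (n+1)` for `0 ≤ n ≤ S` — the constant does not depend on `S`.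
(Measurability and boundedness of `A` follow from the Lipschitz condition: `A` is continuous on the compact
configuration space, and `G` is second countable through the faithful representation `r`.) [folklore] -/
theorem temporalDecay_of_sliceHypothesis :
    ∀ (G : Type) [Group G] [TopologicalSpace G] [IsTopologicalGroup G] [CompactSpace G]
      [MeasurableSpace G] [BorelSpace G] (r : LatticeRep G) (β : ℝ), 0 ≤ β → ∀ κ : ℝ, 0 ≤ κ → ∀ S₀ : ℕ,
    (∀ S : ℕ, S₀ ≤ S → ∀ f : GaugeConfig 4 (2 * S + 1) G → ℝ, IsGaugeInvariant f →
      (∀ U V : GaugeConfig 4 (2 * S + 1) G,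
        (∀ e : Edge 4 (2 * S + 1), e.1 0 = 0 → e.2 ≠ 0 → U e = V e) → f U = f V) →
      (∃ K : ℝ, ∀ U V : GaugeConfig 4 (2 * S + 1) G,
        |f U - f V| ≤ K * ∑ e, Real.sqrt (∑ a, ∑ b, ‖(r.ρ (U e) - r.ρ (V e)) a b‖ ^ 2)) →
      ∫ U, (f U - ∫ V, f V ∂(wilsonMeasure r.ρ β : Measure (GaugeConfig 4 (2 * S + 1) G))) ^ 2
          ∂(wilsonMeasure r.ρ β : Measure (GaugeConfig 4 (2 * S + 1) G)) ≤
        κ * ∑ e : Edge 4 (2 * S + 1), (if e.1 0 = 0 ∧ e.2 ≠ 0 then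
          ∫ U, (Filter.limsup (fun g : G => |f (Function.update U e g) - f U| /
              Real.sqrt (∑ a, ∑ b, ‖(r.ρ g - r.ρ (U e)) a b‖ ^ 2)) (𝓝[≠] (U e))) ^ 2
            ∂(wilsonMeasure r.ρ β : Measure (GaugeConfig 4 (2 * S + 1) G)) else 0)) →
    ∀ S : ℕ, S₀ ≤ S → 1 ≤ S →
    ∀ μ : Measure (GaugeConfig 4 (2 * S + 1) G),
      μ = (wilsonMeasure r.ρ β : Measure (GaugeConfig 4 (2 * S + 1) G)) →
    ∀ A : GaugeConfig 4 (2 * S + 1) G → ℝ, IsGaugeInvariant A →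
      DependsOn A {e : Edge 4 (2 * S + 1) | e.1 0 = 0 ∧ e.1 1 = 0 ∧ e.2 ≠ 0 ∧ e.2 ≠ 1} →
      (∃ K : ℝ, ∀ U V : GaugeConfig 4 (2 * S + 1) G,
        |A U - A V| ≤ K * ∑ e, Real.sqrt (∑ a, ∑ b, ‖(r.ρ (U e) - r.ρ (V e)) a b‖ ^ 2)) →
    ∀ n : ℕ, n ≤ S →
      ∫ U, A U * A (torusConfigShift (Pi.single (0 : Fin 4) (n : ZMod (2 * S + 1)) : Site 4 (2 * S + 1)) U) ∂μ -
          (∫ U, A U ∂μ) * ∫ U, A U ∂μ ≤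
        κ * (∑ e : Edge 4 (2 * S + 1), (if e.1 0 = 0 ∧ e.2 ≠ 0 then
          ∫ U, (Filter.limsup (fun g : G => |A (Function.update U e g) - A U| /
              Real.sqrt (∑ a, ∑ b, ‖(r.ρ g - r.ρ (U e)) a b‖ ^ 2)) (𝓝[≠] (U e))) ^ 2 ∂μ else 0)) /
          ((n : ℝ) + 1) := by
  intro G _ _ _ _ _ _ r β hβ κ hκ S₀ hP S hS₀ hS μ hμ A hAg hAd hAl n hn
  haveI : SecondCountableTopology G :=
    (r.continuous.isClosedEmbedding r.injective).isEmbedding.secondCountableTopology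
  have hAc : Continuous A :=
    Summit.QuantumFields.YangMills.Theorems.BrascampLiebVacuum.rpHankel_continuous r hAl
  have hAm : Measurable A := hAc.measurable
  have hAb : ∃ M : ℝ, ∀ U, |A U| ≤ M :=
    Summit.QuantumFields.YangMills.Theorems.BrascampLiebVacuum.rpHankel_bounded hAc
  exact temporalDecay_of_slicePoincare G r β hβ κ hκ S hS (hP S hS₀) μ hμ A hAm hAb hAg hAd hAl n hn

end Summit.QuantumFields.YangMills.Theorems.PoincareToGap

end
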